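import Literature.Topology.FourManifolds.MTorusCoordinates
import HarnessLib

/-!
# The chart of the surgery piece at the cap end of Gompf's disc

Infrastructure for the explicit fishtail neighbourhood (R. Gompf, *More Cappell–Shaneson spheres
are standard*, Algebr. Geom. Topol. 10 (2010), proof of Thm 2.1 and Lemma 2.2; the named fact
`Literature.Topology.FourManifolds.gompf2010_framedTwist`). The centre of Gompf's disc `D` is a
cap point of the surgered section sphere, i.e. a point of the core sphere `{0} × 𝕊²` of the new
piece `D̊² × 𝕊²` of the circle surgery. Near it the tube about `D` must be written in the product
chart of the new piece. This file provides that chart: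

* `Literature.Topology.FourManifolds.toE2 : ℂ → ℝ²` (inverse of the tree's `toC`);
* `Literature.Topology.FourManifolds.thetaPt (P, Q) = (√(1 - P² - Q²), P, -Q) ∈ 𝕊²` — the graph
  chart of the hemisphere `{θ₀ > 0}` with inverse `thetaInv θ = (θ₁, -θ₂)`, as a partial
  diffeomorphism `thetaChart : ℝ² ⇀ 𝕊²`;
* `Literature.Topology.FourManifolds.capEndChart c : ℂ × ℝ × ℝ ⇀ D̊² × 𝕊²`,
  `(ζ, a, b) ↦ (ζ, thetaPt (c a, c b))`, a partial diffeomorphism onto `{θ₀ > 0}`;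
* `Literature.Topology.FourManifolds.capEnd ν c = ν.glueData.inr ∘ capEndChart c`, a local
  diffeomorphism into the surgered manifold at every point of the source
  (`isLocalDiffeomorphAt_capEnd`), and its expression through the old piece off the centre
  (`capEnd_eq_inl`: `inr (ζ, θ) = inl (ν (ζ/‖ζ‖, ‖ζ‖ θ))`);
* the mirrored versions at the north cap centre `-e₀`: `reflX`, `reflS` (the reflection
  `(x, y, z) ↦ (-x, y, z)` as a diffeomorphism of `𝕊²`), `reflD` (on `D̊² × 𝕊²`),
  `Literature.Topology.FourManifolds.capEndN`, `isLocalDiffeomorphAt_capEndN`, `capEndN_eq_inl`.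

Everything is proved; no named facts.

## References

* R. E. Gompf, *More Cappell–Shaneson spheres are standard*, Algebr. Geom. Topol. 10 (2010)
  1665–1681, proof of Thm 2.1 and Lemma 2.2. [GompfAGT2010]
* R. E. Gompf and A. I. Stipsicz, *4-manifolds and Kirby calculus*, GSM 20, AMS (1999), §5.2. [GompfStipsicz1999]
-/

noncomputable section

open scoped Real ContDiff Topology Manifold
open Set Function Filter Metric Module

namespace Literature.Topology.FourManifolds

universe u

local notation "𝔼 " n:arg => EuclideanSpace ℝ (Fin n)
local notation "𝕊 " n:arg => (Metric.sphere (0 : EuclideanSpace ℝ (Fin (n + 1))) 1)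

attribute [local instance] fact_finrank_euclideanSpace_succ

/-! ### `ℂ → ℝ²` -/

section ToE2

/-- **The identification `ℂ → ℝ²`**, inverse to the tree's `toC`. [folklore] -/
def toE2 (z : ℂ) : 𝔼 2 := WithLp.toLp 2 ![z.re, z.im]

/-- `toC ∘ toE2 = id`. [folklore] -/
@[simp] theorem toC_toE2 (z : ℂ) : toC (toE2 z) = z := by
  apply Complex.ext <;> simp [toE2, toC]

/-- `toE2 ∘ toC = id`. [folklore] -/
@[simp] theorem toE2_toC (v : 𝔼 2) : toE2 (toC v) = v := by
  ext i; fin_cases i <;> simp [toE2, toC]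

/-- `toE2` is smooth (real linear). [folklore] -/
theorem contDiff_toE2 : ContDiff ℝ ∞ toE2 := by
  unfold toE2
  rw [contDiff_piLp]
  intro i
  fin_cases i
  · exact Complex.reCLM.contDiff
  · exact Complex.imCLM.contDiff

/-- `toE2` preserves the norm. [folklore] -/
@[simp] theorem norm_toE2 (z : ℂ) : ‖toE2 z‖ = ‖z‖ := by
  rw [EuclideanSpace.norm_eq, Complex.norm_eq_sqrt_sq_add_sq]
  simp [toE2, Fin.sum_univ_two]

/-- `toE2 z = 0 ↔ z = 0`. [folklore] -/
theorem toE2_eq_zero_iff {z : ℂ} : toE2 z = 0 ↔ z = 0 := by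
  rw [← norm_eq_zero, norm_toE2, norm_eq_zero]

end ToE2

/-! ### The graph chart of the hemisphere -/

section Theta

/-- The unit vector `(√(1 - P² - Q²), P, -Q)`. [folklore] -/
def thetaVec (p : ℝ × ℝ) : 𝔼 3 := WithLp.toLp 2 ![Real.sqrt (1 - p.1 ^ 2 - p.2 ^ 2), p.1, -p.2]

/-- It is a unit vector on the closed unit disc. [folklore] -/
theorem norm_thetaVec {p : ℝ × ℝ} (h : p.1 ^ 2 + p.2 ^ 2 ≤ 1) : ‖thetaVec p‖ = 1 := by
  rw [thetaVec, EuclideanSpace.norm_eq]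
  simp only [Fin.sum_univ_three, Matrix.cons_val_zero, Matrix.cons_val_one, Matrix.cons_val,
    Real.norm_eq_abs, sq_abs, neg_sq]
  rw [Real.sq_sqrt (by linarith), show 1 - p.1 ^ 2 - p.2 ^ 2 + p.1 ^ 2 + p.2 ^ 2 = 1 by ring, Real.sqrt_one]

/-- **The graph chart of the hemisphere `{θ₀ > 0}`** (junk off the open unit disc). [folklore] -/
def thetaPt (p : ℝ × ℝ) : 𝕊 2 := by
  classical
  exact if h : p.1 ^ 2 + p.2 ^ 2 < 1 then ⟨thetaVec p, by rw [mem_sphere_zero_iff_norm, norm_thetaVec h.le]⟩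
    else spherePt 2

/-- The inverse chart `θ ↦ (θ₁, -θ₂)`. [folklore] -/
def thetaInv (θ : 𝕊 2) : ℝ × ℝ := ((θ : 𝔼 3) 1, -(θ : 𝔼 3) 2)

/-- The value of the chart on the open unit disc. [folklore] -/
theorem coe_thetaPt {p : ℝ × ℝ} (h : p.1 ^ 2 + p.2 ^ 2 < 1) : (thetaPt p : 𝔼 3) = thetaVec p := by
  rw [thetaPt, dif_pos h]

/-- `thetaInv ∘ thetaPt = id` on the open unit disc. [folklore] -/
theorem thetaInv_thetaPt {p : ℝ × ℝ} (h : p.1 ^ 2 + p.2 ^ 2 < 1) : thetaInv (thetaPt p) = p := by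
  rw [thetaInv, coe_thetaPt h]
  obtain ⟨P, Q⟩ := p
  simp [thetaVec]

/-- On the hemisphere `θ₀ > 0`: `θ₁² + θ₂² < 1`. [folklore] -/
theorem sq_add_sq_lt_one {θ : 𝕊 2} (h : 0 < (θ : 𝔼 3) 0) : ((θ : 𝔼 3) 1) ^ 2 + (-(θ : 𝔼 3) 2) ^ 2 < 1 := by
  have hn : ‖(θ : 𝔼 3)‖ = 1 := by simp
  have hsq : ‖(θ : 𝔼 3)‖ ^ 2 = (θ : 𝔼 3) 0 ^ 2 + (θ : 𝔼 3) 1 ^ 2 + (θ : 𝔼 3) 2 ^ 2 := by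
    rw [EuclideanSpace.norm_eq, Real.sq_sqrt (by positivity)]
    simp [Fin.sum_univ_three]
  rw [hn] at hsq
  nlinarith

/-- `thetaPt ∘ thetaInv = id` on the hemisphere `θ₀ > 0`. [folklore] -/
theorem thetaPt_thetaInv {θ : 𝕊 2} (h : 0 < (θ : 𝔼 3) 0) : thetaPt (thetaInv θ) = θ := by
  have hlt := sq_add_sq_lt_one h
  have hn : ‖(θ : 𝔼 3)‖ = 1 := by simp
  have hsq : (θ : 𝔼 3) 0 ^ 2 + (θ : 𝔼 3) 1 ^ 2 + (θ : 𝔼 3) 2 ^ 2 = 1 := by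
    have : ‖(θ : 𝔼 3)‖ ^ 2 = (θ : 𝔼 3) 0 ^ 2 + (θ : 𝔼 3) 1 ^ 2 + (θ : 𝔼 3) 2 ^ 2 := by
      rw [EuclideanSpace.norm_eq, Real.sq_sqrt (by positivity)]
      simp [Fin.sum_univ_three]
    rw [← this, hn, one_pow]
  ext1
  rw [coe_thetaPt (by simpa [thetaInv] using hlt)]
  ext i
  fin_cases i
  · simp only [thetaVec, thetaInv]
    simp only [Fin.zero_eta, Matrix.cons_val_zero, neg_sq]
    rw [show 1 - (θ : 𝔼 3) 1 ^ 2 - (θ : 𝔼 3) 2 ^ 2 = (θ : 𝔼 3) 0 ^ 2 by linarith]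
    exact Real.sqrt_sq h.le
  · simp [thetaVec, thetaInv]
  · simp [thetaVec, thetaInv]

/-- Smoothness of the unit vector on the open unit disc. [folklore] -/
theorem contDiffAt_thetaVec {p : ℝ × ℝ} (h : p.1 ^ 2 + p.2 ^ 2 < 1) : ContDiffAt ℝ ∞ thetaVec p := by
  unfold thetaVec
  rw [contDiffAt_piLp]
  intro i
  fin_cases i
  · simp only [Fin.zero_eta, Matrix.cons_val_zero]
    refine ContDiffAt.sqrt ?_ (by linarith : 1 - p.1 ^ 2 - p.2 ^ 2 ≠ 0)
    exact (contDiffAt_const.sub (contDiffAt_fst.pow 2)).sub (contDiffAt_snd.pow 2)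
  · exact contDiffAt_fst
  · exact contDiffAt_snd.neg

/-- The inverse chart is smooth on the whole sphere. [folklore] -/
theorem contMDiff_thetaInv : ContMDiff (𝓡 2) 𝓘(ℝ, ℝ × ℝ) ∞ thetaInv := by
  have hc : ContMDiff (𝓡 2) 𝓘(ℝ, 𝔼 3) ∞ (fun θ : 𝕊 2 ↦ (θ : 𝔼 3)) := contMDiff_coe_sphere
  have h1 : ContMDiff (𝓡 2) 𝓘(ℝ, ℝ) ∞ (fun θ : 𝕊 2 ↦ (θ : 𝔼 3) 1) :=
    ((contDiff_piLp_apply (p := 2) (i := (1 : Fin 3))).contMDiff).comp hc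
  have h2 : ContMDiff (𝓡 2) 𝓘(ℝ, ℝ) ∞ (fun θ : 𝕊 2 ↦ -(θ : 𝔼 3) 2) :=
    ((contDiff_piLp_apply (p := 2) (i := (2 : Fin 3))).neg.contMDiff).comp hc
  exact h1.prodMk_space h2

/-- **The graph chart as a partial diffeomorphism `ℝ² ⇀ 𝕊²`** from the open unit disc onto the
hemisphere `{θ₀ > 0}`. [folklore] -/
def thetaChart : PartialDiffeomorph 𝓘(ℝ, ℝ × ℝ) (𝓡 2) (ℝ × ℝ) (𝕊 2) ∞ where
  toFun := thetaPt
  invFun := thetaInv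
  source := {p | p.1 ^ 2 + p.2 ^ 2 < 1}
  target := {θ | 0 < (θ : 𝔼 3) 0}
  map_source' := by
    intro p hp
    show 0 < (thetaPt p : 𝔼 3) 0
    rw [coe_thetaPt hp]
    simp only [thetaVec, PiLp.toLp_apply, Matrix.cons_val_zero]
    exact Real.sqrt_pos.2 (by have := hp.out; linarith)
  map_target' := by
    intro θ hθ
    show (thetaInv θ).1 ^ 2 + (thetaInv θ).2 ^ 2 < 1
    exact sq_add_sq_lt_one hθ
  left_inv' := fun p hp ↦ thetaInv_thetaPt hp
  right_inv' := fun θ hθ ↦ thetaPt_thetaInv hθ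
  open_source := isOpen_lt ((continuous_fst.pow 2).add (continuous_snd.pow 2)) continuous_const
  open_target := by
    have hc : Continuous fun θ : 𝕊 2 ↦ (θ : 𝔼 3) 0 :=
      (PiLp.continuous_apply 2 (fun _ : Fin 3 ↦ ℝ) 0).comp continuous_subtype_val
    exact isOpen_lt continuous_const hc
  contMDiffOn_toFun := by
    let U : TopologicalSpace.Opens (ℝ × ℝ) :=
      ⟨{p | p.1 ^ 2 + p.2 ^ 2 < 1}, isOpen_lt ((continuous_fst.pow 2).add (continuous_snd.pow 2)) continuous_const⟩
    change ContMDiffOn 𝓘(ℝ, ℝ × ℝ) (𝓡 2) ∞ thetaPt (U : Set (ℝ × ℝ))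
    rw [contMDiffOn_iff_contMDiff_opens]
    have h1 : ContMDiff 𝓘(ℝ, ℝ × ℝ) 𝓘(ℝ, 𝔼 3) ∞ fun p : U ↦ thetaVec (p : ℝ × ℝ) := by
      intro p
      exact (contMDiffAt_subtype_iff (f := thetaVec)).2 (contDiffAt_thetaVec p.2).contMDiffAt
    have h2 : ∀ p : U, thetaVec (p : ℝ × ℝ) ∈ sphere (0 : 𝔼 3) 1 := fun p ↦ by
      rw [mem_sphere_zero_iff_norm, norm_thetaVec (le_of_lt p.2)]
    have heq : (fun p : U ↦ thetaPt (p : ℝ × ℝ)) = Set.codRestrict _ _ h2 := by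
      funext p
      ext1
      exact coe_thetaPt p.2
    rw [heq]
    exact h1.codRestrict_sphere h2
  contMDiffOn_invFun := contMDiff_thetaInv.contMDiffOn

/-- **The graph chart is a local diffeomorphism** at points of the open unit disc. [folklore] -/
theorem isLocalDiffeomorphAt_thetaPt {p : ℝ × ℝ} (h : p.1 ^ 2 + p.2 ^ 2 < 1) :
    IsLocalDiffeomorphAt 𝓘(ℝ, ℝ × ℝ) (𝓡 2) ∞ thetaPt p :=
  PartialDiffeomorph.isLocalDiffeomorphAt 𝓘(ℝ, ℝ × ℝ) (𝓡 2) ∞ thetaChart h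

end Theta

/-! ### The chart of the new piece -/

section CapEnd

/-- The squash into the open unit disc (identity there, junk `0` outside). [folklore] -/
def sqz (z : ℂ) : ℂ := by
  classical
  exact if ‖z‖ < 1 then z else 0

/-- `sqz z = z` on the open unit disc. [folklore] -/
theorem sqz_of_lt {z : ℂ} (h : ‖z‖ < 1) : sqz z = z := by rw [sqz, if_pos h]

/-- `‖sqz z‖ < 1` always. [folklore] -/
theorem norm_sqz_lt (z : ℂ) : ‖sqz z‖ < 1 := by
  unfold sqz; split_ifs with h
  · exact h
  · simp

variable (c : ℝ)

/-- The disc-and-sphere point of `(ζ, a, b)`: `(toE2 ζ, thetaPt (c a, c b))` (with `ζ` squashed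
into the unit disc). [folklore] -/
def capEndPt (q : ℂ × ℝ × ℝ) : ↥discTimesSphere :=
  ⟨(toE2 (sqz q.1), thetaPt (c * q.2.1, c * q.2.2)), by
    rw [mem_discTimesSphere_iff, norm_toE2]; exact norm_sqz_lt q.1⟩

/-- The inverse: `(d′, θ) ↦ (toC d′, θ₁/c, -θ₂/c)`. [folklore] -/
def capEndInv (b : ↥discTimesSphere) : ℂ × ℝ × ℝ :=
  (toC (b : (𝔼 2) × (𝕊 2)).1, ((b : (𝔼 2) × (𝕊 2)).2 : 𝔼 3) 1 / c, -((b : (𝔼 2) × (𝕊 2)).2 : 𝔼 3) 2 / c)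

/-- The value of `capEndPt` on the unit disc. [folklore] -/
theorem coe_capEndPt {q : ℂ × ℝ × ℝ} (h : ‖q.1‖ < 1) :
    (capEndPt c q : (𝔼 2) × (𝕊 2)) = (toE2 q.1, thetaPt (c * q.2.1, c * q.2.2)) := by
  simp [capEndPt, sqz_of_lt h]

variable {c}

/-- **The chart of the new piece as a partial diffeomorphism `ℂ × ℝ × ℝ ⇀ D̊² × 𝕊²`.** [folklore] -/
def capEndChart (hc : c ≠ 0) :
    PartialDiffeomorph 𝓘(ℝ, ℂ × ℝ × ℝ) (𝓘(ℝ, 𝔼 2).prod (𝓡 2)) (ℂ × ℝ × ℝ) ↥discTimesSphere ∞ where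
  toFun := capEndPt c
  invFun := capEndInv c
  source := {q | ‖q.1‖ < 1 ∧ (c * q.2.1) ^ 2 + (c * q.2.2) ^ 2 < 1}
  target := {b | 0 < ((b : (𝔼 2) × (𝕊 2)).2 : 𝔼 3) 0}
  map_source' := by
    intro q hq
    show 0 < ((capEndPt c q : (𝔼 2) × (𝕊 2)).2 : 𝔼 3) 0
    rw [coe_capEndPt c hq.1]
    show 0 < ((thetaPt (c * q.2.1, c * q.2.2) : 𝕊 2) : 𝔼 3) 0
    rw [coe_thetaPt (by simpa using hq.2)]
    simp only [thetaVec, PiLp.toLp_apply, Matrix.cons_val_zero]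
    exact Real.sqrt_pos.2 (by have := hq.2; linarith)
  map_target' := by
    intro b hb
    constructor
    · show ‖toC (b : (𝔼 2) × (𝕊 2)).1‖ < 1
      have h := b.2
      rw [mem_discTimesSphere_iff] at h
      rwa [← toE2_toC (b : (𝔼 2) × (𝕊 2)).1, norm_toE2] at h
    · show (c * (((b : (𝔼 2) × (𝕊 2)).2 : 𝔼 3) 1 / c)) ^ 2 + (c * (-((b : (𝔼 2) × (𝕊 2)).2 : 𝔼 3) 2 / c)) ^ 2 < 1
      rw [mul_div_cancel₀ _ hc, mul_div_cancel₀ _ hc]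
      exact sq_add_sq_lt_one hb
  left_inv' := by
    intro q hq
    obtain ⟨ζ, a, b⟩ := q
    simp only [capEndInv]
    rw [coe_capEndPt c hq.1]
    simp only [toC_toE2]
    rw [coe_thetaPt (by simpa using hq.2)]
    simp [thetaVec, mul_div_cancel_left₀ _ hc]
  right_inv' := by
    intro b hb
    ext1
    have h1 : ‖(capEndInv c b).1‖ < 1 := by
      show ‖toC (b : (𝔼 2) × (𝕊 2)).1‖ < 1
      have h := b.2
      rw [mem_discTimesSphere_iff] at h
      rwa [← toE2_toC (b : (𝔼 2) × (𝕊 2)).1, norm_toE2] at h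
    rw [coe_capEndPt c h1]
    simp only [capEndInv, toE2_toC, mul_div_cancel₀ _ hc]
    rw [show (((b : (𝔼 2) × (𝕊 2)).2 : 𝔼 3) 1, -((b : (𝔼 2) × (𝕊 2)).2 : 𝔼 3) 2) =
      thetaInv (b : (𝔼 2) × (𝕊 2)).2 from rfl, thetaPt_thetaInv hb]
  open_source := by
    refine (isOpen_lt (continuous_norm.comp continuous_fst) continuous_const).inter ?_
    exact isOpen_lt (((continuous_const.mul (continuous_fst.comp continuous_snd)).pow 2).add
      ((continuous_const.mul (continuous_snd.comp continuous_snd)).pow 2)) continuous_const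
  open_target := by
    have hc' : Continuous fun b : ↥discTimesSphere ↦ (((b : (𝔼 2) × (𝕊 2)).2 : 𝔼 3)) 0 :=
      (PiLp.continuous_apply 2 (fun _ : Fin 3 ↦ ℝ) 0).comp
        (continuous_subtype_val.comp (continuous_snd.comp continuous_subtype_val))
    exact isOpen_lt continuous_const hc'
  contMDiffOn_toFun := by
    intro q hq
    refine ContMDiffAt.contMDiffWithinAt ?_
    rw [← ContMDiffAt.subtypeVal_comp_iff]
    have ho : IsOpen {q : ℂ × ℝ × ℝ | ‖q.1‖ < 1 ∧ (c * q.2.1) ^ 2 + (c * q.2.2) ^ 2 < 1} := by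
      refine (isOpen_lt (continuous_norm.comp continuous_fst) continuous_const).inter ?_
      exact isOpen_lt (((continuous_const.mul (continuous_fst.comp continuous_snd)).pow 2).add
        ((continuous_const.mul (continuous_snd.comp continuous_snd)).pow 2)) continuous_const
    have hev : (Subtype.val ∘ capEndPt c) =ᶠ[𝓝 q]
        fun q : ℂ × ℝ × ℝ ↦ (toE2 q.1, thetaPt (c * q.2.1, c * q.2.2)) := by
      filter_upwards [ho.mem_nhds hq] with q' hq'
      exact coe_capEndPt c hq'.1
    refine ContMDiffAt.congr_of_eventuallyEq ?_ hev
    refine ContMDiffAt.prodMk ?_ ?_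
    · have h : ContDiff ℝ ∞ fun q : ℂ × ℝ × ℝ ↦ toE2 q.1 := contDiff_toE2.comp contDiff_fst
      exact h.contMDiff.contMDiffAt
    · have hlin : ContMDiff 𝓘(ℝ, ℂ × ℝ × ℝ) 𝓘(ℝ, ℝ × ℝ) ∞ fun q : ℂ × ℝ × ℝ ↦ (c * q.2.1, c * q.2.2) :=
        ((contDiff_const.mul (contDiff_fst.comp contDiff_snd)).prodMk
          (contDiff_const.mul (contDiff_snd.comp contDiff_snd))).contMDiff
      exact (isLocalDiffeomorphAt_thetaPt (by simpa using hq.2)).contMDiffAt.comp q hlin.contMDiffAt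
  contMDiffOn_invFun := by
    have hG : ContMDiff (𝓘(ℝ, 𝔼 2).prod (𝓡 2)) 𝓘(ℝ, ℂ × ℝ × ℝ) ∞
        fun p : (𝔼 2) × (𝕊 2) ↦ ((toC p.1, ((p.2 : 𝔼 3) 1) / c, -((p.2 : 𝔼 3) 2) / c) : ℂ × ℝ × ℝ) := by
      have h1 : ContMDiff (𝓘(ℝ, 𝔼 2).prod (𝓡 2)) 𝓘(ℝ, ℂ) ∞ fun p : (𝔼 2) × (𝕊 2) ↦ toC p.1 :=
        contDiff_toC.contMDiff.comp contMDiff_fst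
      have h2 : ContMDiff (𝓘(ℝ, 𝔼 2).prod (𝓡 2)) 𝓘(ℝ, ℝ × ℝ) ∞ fun p : (𝔼 2) × (𝕊 2) ↦ thetaInv p.2 :=
        contMDiff_thetaInv.comp contMDiff_snd
      have h3 : ContMDiff 𝓘(ℝ, ℝ × ℝ) 𝓘(ℝ, ℝ × ℝ) ∞ fun x : ℝ × ℝ ↦ (x.1 / c, x.2 / c) :=
        ((contDiff_fst.div_const c).prodMk (contDiff_snd.div_const c)).contMDiff
      have h23 := h3.comp h2
      exact h1.prodMk_space h23
    intro b _
    exact ((hG.comp contMDiff_subtype_val).contMDiffAt (x := b)).contMDiffWithinAt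

/-- The source of the chart. [folklore] -/
theorem capEndChart_source (hc : c ≠ 0) :
    (capEndChart hc).source = {q | ‖q.1‖ < 1 ∧ (c * q.2.1) ^ 2 + (c * q.2.2) ^ 2 < 1} := rfl

variable {X : Type u} [TopologicalSpace X] [T2Space X] [ChartedSpace (𝔼 4) X] [IsManifold (𝓡 4) ∞ X]
  {γ : 𝕊 1 → X} (ν : CircleNbhd (𝓡 4) γ)

/-- **The tube near the cap end, in the new piece**: `(ζ, a, b) ↦ inr (toE2 ζ, thetaPt (c a, c b))`. [folklore] -/
def capEnd (c : ℝ) (q : ℂ × ℝ × ℝ) : ν.Surgered := ν.glueData.inr (capEndPt c q)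

/-- **The tube near the cap end is a local diffeomorphism** at every point of the chart's source. [folklore] -/
theorem isLocalDiffeomorphAt_capEnd (hc : c ≠ 0) {q : ℂ × ℝ × ℝ} (h1 : ‖q.1‖ < 1)
    (h2 : (c * q.2.1) ^ 2 + (c * q.2.2) ^ 2 < 1) :
    IsLocalDiffeomorphAt 𝓘(ℝ, ℂ × ℝ × ℝ) 𝓘(ℝ, 𝔼 4) ∞ (capEnd ν c) q := by
  have hA := PartialDiffeomorph.isLocalDiffeomorphAt 𝓘(ℝ, ℂ × ℝ × ℝ) (𝓘(ℝ, 𝔼 2).prod (𝓡 2)) ∞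
    (capEndChart hc) (show q ∈ (capEndChart hc).source from ⟨h1, h2⟩)
  have hB := isLocalDiffeomorphAt_of_isSmoothEmbedding ν.glueData.isSmoothEmbedding_inr
    ν.glueData.isOpen_range_inr (capEndPt c q)
  exact hA.comp (K := 𝓘(ℝ, 𝔼 4)) (P := ν.Surgered) hB

omit [IsManifold (𝓡 4) ∞ X] in
/-- **Off the centre the cap-end tube lies in the old piece**: for `ζ ≠ 0`,
`capEnd (ζ, a, b) = inl (ν (polarInv (toE2 ζ, thetaPt (c a, c b))))`. [folklore] -/
theorem capEnd_eq_inl {q : ℂ × ℝ × ℝ} (h1 : ‖q.1‖ < 1) (h0 : q.1 ≠ 0) :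
    capEnd ν c q = ν.glueData.inl (ν.bwdA (toE2 q.1, thetaPt (c * q.2.1, c * q.2.2))) := by
  have hb : capEndPt c q ∈ ν.glueData.glue.target := by
    rw [CircleNbhd.glueData_glue, CircleNbhd.glue_target]
    show (capEndPt c q : (𝔼 2) × (𝕊 2)).1 ≠ 0
    rw [coe_capEndPt c h1]
    exact fun h ↦ h0 (toE2_eq_zero_iff.1 h)
  rw [capEnd, ← ν.glueData.inl_glue_symm hb, CircleNbhd.glueData_glue, CircleNbhd.glue_symm_apply]
  congr 1
  exact congrArg ν.bwdA (coe_capEndPt c h1)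

omit [IsManifold (𝓡 4) ∞ X] in
/-- The old-piece point off the centre, as a point of `X`: `ν (ζ/‖ζ‖, ‖ζ‖ • θ)`. [folklore] -/
theorem coe_bwdA_capEnd {q : ℂ × ℝ × ℝ} (h0 : q.1 ≠ 0) :
    (ν.bwdA (toE2 q.1, thetaPt (c * q.2.1, c * q.2.2)) : X) =
      ν.toFun (CircleNbhd.polarInv (toE2 q.1, thetaPt (c * q.2.1, c * q.2.2))) :=
  ν.coe_bwdA_apply (by simpa [toE2_eq_zero_iff] using h0)

end CapEnd

/-! ### The mirrored chart at the north cap centre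

The north cap centre is the antipodal point `-e₀` of the core sphere; its graph chart is the
south one followed by the reflection `(x, y, z) ↦ (-x, y, z)`, an isometry of `𝕊²`. -/

section North

/-- The reflection `(x, y, z) ↦ (-x, y, z)` of `ℝ³`. [folklore] -/
def reflX (v : 𝔼 3) : 𝔼 3 := WithLp.toLp 2 ![-v 0, v 1, v 2]

/-- The reflection is an involution. [folklore] -/
@[simp] theorem reflX_reflX (v : 𝔼 3) : reflX (reflX v) = v := by
  ext j; fin_cases j <;> simp [reflX]

/-- The reflection preserves the norm. [folklore] -/
@[simp] theorem norm_reflX (v : 𝔼 3) : ‖reflX v‖ = ‖v‖ := by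
  simp [reflX, EuclideanSpace.norm_eq, Fin.sum_univ_three]

/-- The reflection is smooth (linear). [folklore] -/
theorem contDiff_reflX : ContDiff ℝ ∞ reflX := by
  unfold reflX
  rw [contDiff_piLp]
  intro j
  fin_cases j
  · exact (contDiff_piLp_apply (p := 2) (i := (0 : Fin 3))).neg
  · exact contDiff_piLp_apply (p := 2) (i := (1 : Fin 3))
  · exact contDiff_piLp_apply (p := 2) (i := (2 : Fin 3))

/-- **The reflection as a diffeomorphism of the sphere.** [folklore] -/
def reflS : (𝕊 2) ≃ₘ⟮𝓡 2, 𝓡 2⟯ (𝕊 2) where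
  toFun θ := ⟨reflX θ, by rw [mem_sphere_zero_iff_norm, norm_reflX]; simp⟩
  invFun θ := ⟨reflX θ, by rw [mem_sphere_zero_iff_norm, norm_reflX]; simp⟩
  left_inv θ := by ext1; exact reflX_reflX _
  right_inv θ := by ext1; exact reflX_reflX _
  contMDiff_toFun := by
    have h1 : ContMDiff (𝓡 2) 𝓘(ℝ, 𝔼 3) ∞ fun θ : 𝕊 2 ↦ reflX (θ : 𝔼 3) := contDiff_reflX.contMDiff.comp contMDiff_coe_sphere
    have h2 : ∀ θ : 𝕊 2, reflX (θ : 𝔼 3) ∈ sphere (0 : 𝔼 3) 1 := fun θ ↦ by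
      rw [mem_sphere_zero_iff_norm, norm_reflX]; simp
    exact h1.codRestrict_sphere h2
  contMDiff_invFun := by
    have h1 : ContMDiff (𝓡 2) 𝓘(ℝ, 𝔼 3) ∞ fun θ : 𝕊 2 ↦ reflX (θ : 𝔼 3) := contDiff_reflX.contMDiff.comp contMDiff_coe_sphere
    have h2 : ∀ θ : 𝕊 2, reflX (θ : 𝔼 3) ∈ sphere (0 : 𝔼 3) 1 := fun θ ↦ by
      rw [mem_sphere_zero_iff_norm, norm_reflX]; simp
    exact h1.codRestrict_sphere h2

/-- The value of `reflS`. [folklore] -/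
@[simp] theorem coe_reflS (θ : 𝕊 2) : ((reflS θ : 𝕊 2) : 𝔼 3) = reflX θ := rfl

/-- **The reflection on the new piece** `(d′, θ) ↦ (d′, reflS θ)`, a diffeomorphism of `D̊² × 𝕊²`. [folklore] -/
def reflD : (↥discTimesSphere) ≃ₘ⟮𝓘(ℝ, 𝔼 2).prod (𝓡 2), 𝓘(ℝ, 𝔼 2).prod (𝓡 2)⟯ ↥discTimesSphere where
  toFun b := ⟨((b : (𝔼 2) × (𝕊 2)).1, reflS (b : (𝔼 2) × (𝕊 2)).2), by
    rw [mem_discTimesSphere_iff]; exact b.2⟩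
  invFun b := ⟨((b : (𝔼 2) × (𝕊 2)).1, reflS (b : (𝔼 2) × (𝕊 2)).2), by
    rw [mem_discTimesSphere_iff]; exact b.2⟩
  left_inv b := by
    ext1
    refine Prod.ext rfl ?_
    exact reflS.left_inv _
  right_inv b := by
    ext1
    refine Prod.ext rfl ?_
    exact reflS.left_inv _
  contMDiff_toFun := by
    intro b
    rw [← ContMDiffAt.subtypeVal_comp_iff]
    have hG : ContMDiff (𝓘(ℝ, 𝔼 2).prod (𝓡 2)) (𝓘(ℝ, 𝔼 2).prod (𝓡 2)) ∞
        fun p : (𝔼 2) × (𝕊 2) ↦ (p.1, reflS p.2) := contMDiff_fst.prodMk (reflS.contMDiff.comp contMDiff_snd)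
    exact (hG.comp contMDiff_subtype_val).contMDiffAt
  contMDiff_invFun := by
    intro b
    rw [← ContMDiffAt.subtypeVal_comp_iff]
    have hG : ContMDiff (𝓘(ℝ, 𝔼 2).prod (𝓡 2)) (𝓘(ℝ, 𝔼 2).prod (𝓡 2)) ∞
        fun p : (𝔼 2) × (𝕊 2) ↦ (p.1, reflS p.2) := contMDiff_fst.prodMk (reflS.contMDiff.comp contMDiff_snd)
    exact (hG.comp contMDiff_subtype_val).contMDiffAt

/-- The value of `reflD`. [folklore] -/
@[simp] theorem coe_reflD (b : ↥discTimesSphere) :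
    ((reflD b : ↥discTimesSphere) : (𝔼 2) × (𝕊 2)) = ((b : (𝔼 2) × (𝕊 2)).1, reflS (b : (𝔼 2) × (𝕊 2)).2) := rfl

variable {c : ℝ}
variable {X : Type u} [TopologicalSpace X] [T2Space X] [ChartedSpace (𝔼 4) X] [IsManifold (𝓡 4) ∞ X]
  {γ : 𝕊 1 → X} (ν : CircleNbhd (𝓡 4) γ)

/-- **The tube near the north cap centre, in the new piece**:
`(ζ, a, b) ↦ inr (toE2 ζ, reflS (thetaPt (c a, c b)))` (the graph chart of the hemisphere `{θ₀ < 0}`). [folklore] -/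
def capEndN (c : ℝ) (q : ℂ × ℝ × ℝ) : ν.Surgered := ν.glueData.inr (reflD (capEndPt c q))

/-- **The north tube is a local diffeomorphism** at every point of the chart's source. [folklore] -/
theorem isLocalDiffeomorphAt_capEndN (hc : c ≠ 0) {q : ℂ × ℝ × ℝ} (h1 : ‖q.1‖ < 1)
    (h2 : (c * q.2.1) ^ 2 + (c * q.2.2) ^ 2 < 1) :
    IsLocalDiffeomorphAt 𝓘(ℝ, ℂ × ℝ × ℝ) 𝓘(ℝ, 𝔼 4) ∞ (capEndN ν c) q := by
  have hA := PartialDiffeomorph.isLocalDiffeomorphAt 𝓘(ℝ, ℂ × ℝ × ℝ) (𝓘(ℝ, 𝔼 2).prod (𝓡 2)) ∞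
    (capEndChart hc) (show q ∈ (capEndChart hc).source from ⟨h1, h2⟩)
  have hR := reflD.isLocalDiffeomorph (capEndPt c q)
  have hB := isLocalDiffeomorphAt_of_isSmoothEmbedding ν.glueData.isSmoothEmbedding_inr
    ν.glueData.isOpen_range_inr (reflD (capEndPt c q))
  exact (hA.comp (K := 𝓘(ℝ, 𝔼 2).prod (𝓡 2)) (P := ↥discTimesSphere) hR).comp (K := 𝓘(ℝ, 𝔼 4)) (P := ν.Surgered) hB

omit [IsManifold (𝓡 4) ∞ X] in
/-- **Off the centre the north tube lies in the old piece**: for `ζ ≠ 0`,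
`capEndN (ζ, a, b) = inl (ν (polarInv (toE2 ζ, reflS (thetaPt (c a, c b)))))`. [folklore] -/
theorem capEndN_eq_inl {q : ℂ × ℝ × ℝ} (h1 : ‖q.1‖ < 1) (h0 : q.1 ≠ 0) :
    capEndN ν c q = ν.glueData.inl (ν.bwdA (toE2 q.1, reflS (thetaPt (c * q.2.1, c * q.2.2)))) := by
  have hval : ((reflD (capEndPt c q) : ↥discTimesSphere) : (𝔼 2) × (𝕊 2)) =
      (toE2 q.1, reflS (thetaPt (c * q.2.1, c * q.2.2))) := by
    rw [coe_reflD, coe_capEndPt c h1]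
  have hb : (reflD (capEndPt c q) : ↥discTimesSphere) ∈ ν.glueData.glue.target := by
    rw [CircleNbhd.glueData_glue, CircleNbhd.glue_target]
    show ((reflD (capEndPt c q) : ↥discTimesSphere) : (𝔼 2) × (𝕊 2)).1 ≠ 0
    rw [hval]
    exact fun h ↦ h0 (toE2_eq_zero_iff.1 h)
  rw [capEndN, ← ν.glueData.inl_glue_symm hb, CircleNbhd.glueData_glue, CircleNbhd.glue_symm_apply]
  congr 1
  exact congrArg ν.bwdA hval

/-- The value of the north chart in `ℝ³`: `reflX (√(1 - P² - Q²), P, -Q) = (-√(1 - P² - Q²), P, -Q)`. [folklore] -/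
theorem coe_reflS_thetaPt {p : ℝ × ℝ} (h : p.1 ^ 2 + p.2 ^ 2 < 1) :
    ((reflS (thetaPt p) : 𝕊 2) : 𝔼 3) = WithLp.toLp 2 ![-Real.sqrt (1 - p.1 ^ 2 - p.2 ^ 2), p.1, -p.2] := by
  rw [coe_reflS, coe_thetaPt h]
  ext j; fin_cases j <;> simp [reflX, thetaVec]

end North

end Literature.Topology.FourManifolds
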